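import Mathlib
import Summits.KontsevichZagierPeriods.Zeta5Search.BrickLevelReductionInf
import Summits.KontsevichZagierPeriods.Zeta5Search.BrickPropositionH

/-!
# BrickPropositionHInf — zi-p2's THEOREM 10 (v) PROPOSITION H^∞ and (vi) DIGIT THEOREM 10 in kernel: PROPOSITION H°
at EVERY level (no `ℓ ≤ A`), and `v(Σ_{j≤n} u(j)·r_j^{(s)}(n)) ≥ L(n)` for the Ball/Rivoal brick kernels at EVERY level
(cell zeta5-irr)

HONEST FRAMING: systematic search; no irrationality claim unless certified. INSTRUMENT theorems of the ζ(5)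
census cell zeta5-irr (HOME `run/shared/lean/pub/zeta5-irr/`; memo `zi-p2/probes/B8/thm10/THEOREM10.md` (sealed
eeb9a92811d678e0) §2 «(v) PROPOSITION H^∞. PROPOSITION H° holds at EVERY level: for every row M of R̃ (any ℓ = L(M) ≥
0), every weight g admissible for M at level ℓ and every s ∈ {0} ∪ [1,A]: v(Σ_{k=0}^{M} g(k)·r̃_k^{(s)}(M)) ≥ ℓ. (vi)
DIGIT THEOREM 10. For every n ≥ p (any L = L(n) ≥ 1) and every s ∈ {0,…,A}: v(Σ_{j=0}^{n}u(j)r_j^{(s)}(n)) ≥ L»; proof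
of (v): «THEOREM8's proof of H°, step (1) («holes, termwise» …) is replaced by (1^∞): by (iv) … the induction
H°(ℓ−1), H°(≤ ℓ−1) ⇒ H°(ℓ) runs at EVERY level»). In the nominal-level form of `BrickPropositionH` (row `M < p^{ℓ+1}`,
normalisation `p^{ℓ(A−s)}`) the induction is ordinary: the hole cells of `n = n₀ + Np` land on the row `N − 1 <
p^{L+1}` with the weight `G/p^A` (`BrickHoleWeight`), admissible at level `L`, and `A ≥ 2` absorbs the one lost level.
WHAT THIS IS NOT: not an irrationality statement; nothing about ζ(5); 0 nats/n; rung F-Z1 NOT moved. Filed by the engine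
seat zi-eng (g10); inputs `BrickLevelReductionInf` (reduction without level hypothesis), `BrickBlockWeight` (° block
weight laws), `BrickHoleWeight` (hole weight laws), `BrickWeightLocality` (LEMMA 4), `BrickPropositionH` (level 0).

## The statements (`p` odd prime — `p ≥ 5` for the digit theorem —, `A` even, `1 ≤ B`, `2B ≤ A`)

* `level_step_inf`: the induction step for either kernel `ε ≤ 1` (harmonic cell and cells), the hypothesis at level `L`
  being used for the rows `N` (° cells) and `N − 1` (hole cells).
* **`propositionH_inf`**: for EVERY `ℓ`, every `M < p^{ℓ+1}` and admissible `g`: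
  `v(Σ_{k≤M} g(k)·p^{ℓ(A−s)}c̃_{k,s}(M)) ≤ exp(−ℓ)` for every `s`, and the harmonic cell.
* **`digitTheorem_inf`** (DIGIT THEOREM 10, `p ≥ 5`): for EVERY `L` and `n < p^{L+2}`: the harmonic cell (`.1`) and
  `v(Σ_{j≤n} u_n(j)·p^{(L+1)(A−s)}c_{j,s}(n)) ≤ exp(−(L+1))` for all `s` (`.2`) (stated harmonic-cell first).
-/

namespace Summit.KontsevichZagierPeriods.Zeta5Search.BrickPropositionHInf

open Finset Nat WithZero
open Summit.KontsevichZagierPeriods.Zeta5Search.BrickTopCoefficient (cTop)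
open Summit.KontsevichZagierPeriods.Zeta5Search.BrickLaurent (cell)
open Summit.KontsevichZagierPeriods.Zeta5Search.BrickPartialFractions (cellZero)
open Summit.KontsevichZagierPeriods.Zeta5Search.BrickLevelReduction (blockWeight)
open Summit.KontsevichZagierPeriods.Zeta5Search.BrickBlockWeight (blockWeight_le blockWeight_reflect_add_le
  blockWeight_local)
open Summit.KontsevichZagierPeriods.Zeta5Search.BrickHoleWeight (holeWeight holeWeight_le holeWeight_reflect_add_le
  holeWeight_local)
open Summit.KontsevichZagierPeriods.Zeta5Search.BrickWeightLocality (phiWeight padicValuation_phiWeight_le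
  phiWeight_reflect padicValuation_phiWeight_sub_le)
open Summit.KontsevichZagierPeriods.Zeta5Search.BrickPropositionH (padicValuation_div_prime_le propositionH)
open Summit.KontsevichZagierPeriods.Zeta5Search.BrickLevelReductionInf (level_reduction_inf level_reduction_inf_zero)

noncomputable section

variable {p : ℕ} [Fact p.Prime]

/-- Division by `p^A` raises the valuation bound by `A`: `v(x) ≤ exp(m) ⇒ v(x/p^A) ≤ exp(m + A)`. -/
theorem padicValuation_div_pow_le {x : ℚ} {m : ℤ} (A : ℕ) (h : Rat.padicValuation p x ≤ exp m) :
    Rat.padicValuation p (x / (p : ℚ) ^ A) ≤ exp (m + A) := by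
  rw [map_div₀, map_pow, Rat.padicValuation_self, ← exp_nsmul, div_le_iff₀ (zero_lt_iff.2 exp_ne_zero), ← exp_add,
    nsmul_eq_mul, mul_neg_one]
  simpa using h

/-! ## The induction step (either kernel) -/

section step

variable (hp2 : p ≠ 2) {A B ε N n₀ L : ℕ} (hA : Even A) (hB : 1 ≤ B) (hAB : 2 * B ≤ A) (hε : ε ≤ 1)
  (hn₀ : n₀ < p) (hN : N < p ^ (L + 1)) {g : ℕ → ℚ}
  (hgI : ∀ k, k ≤ n₀ + N * p → Rat.padicValuation p (g k) ≤ 1)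
  (hgS : ∀ k, k ≤ n₀ + N * p →
    Rat.padicValuation p (g (n₀ + N * p - k) + (-1) ^ ε * g k) ≤ exp (-((L : ℤ) + 1)))
  (hgD : ∀ e k k', 1 ≤ e → e ≤ L + 1 → k ≤ n₀ + N * p → k' ≤ n₀ + N * p → (p : ℤ) ^ e ∣ (k : ℤ) - k' →
    Rat.padicValuation p (g k' - g k) ≤ exp (-(e : ℤ)))
  (IH : ∀ M, M < p ^ (L + 1) → ∀ g' : ℕ → ℚ, (∀ K, K ≤ M → Rat.padicValuation p (g' K) ≤ 1) →
    (∀ K, K ≤ M → Rat.padicValuation p (g' (M - K) + g' K) ≤ exp (-(L : ℤ))) →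
    (∀ e K K', 1 ≤ e → e ≤ L → K ≤ M → K' ≤ M → (p : ℤ) ^ e ∣ (K : ℤ) - K' →
      Rat.padicValuation p (g' K' - g' K) ≤ exp (-(e : ℤ))) →
    (∀ s, Rat.padicValuation p (∑ K ∈ range (M + 1), g' K * ((p : ℚ) ^ (L * (A - s)) * cell A B 0 M K s)) ≤
      exp (-(L : ℤ))) ∧
    Rat.padicValuation p (∑ K ∈ range (M + 1), g' K * ((p : ℚ) ^ (L * A) * cellZero A B 0 M K)) ≤ exp (-(L : ℤ)))
include hp2 hA hB hAB hε hn₀ hN hgI hgS hgD IH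

/-- **THE INDUCTION STEP WITHOUT LEVEL HYPOTHESIS** (zi-p2 THEOREM 10, proof of (v): steps (1^∞)(2)–(5)): if H°
holds at level `L` for every row `M < p^{L+1}` and every admissible weight, then for the row `n = n₀ + Np` (kernel
`ε ≤ 1`) and every `g` satisfying (I), (S_ε), (D) at level `L+1`: `v(Σ_{k≤n} g(k)·r_k^{(s)}(n)) ≥ L+1`, all `s`, and the
harmonic cell — via `W = p·ω` on the row `N` and `G = p^A·γ` on the row `N − 1`. -/
theorem level_step_inf :
    Rat.padicValuation p (∑ k ∈ range (n₀ + N * p + 1),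
      g k * ((p : ℚ) ^ ((L + 1) * A) * cellZero A B ε (n₀ + N * p) k)) ≤ exp (-((L : ℤ) + 1)) ∧
    (∀ s, Rat.padicValuation p (∑ k ∈ range (n₀ + N * p + 1),
      g k * ((p : ℚ) ^ ((L + 1) * (A - s)) * cell A B ε (n₀ + N * p) k s)) ≤ exp (-((L : ℤ) + 1))) := by
  have hp : p.Prime := Fact.out
  have hpQ : (p : ℚ) ≠ 0 := by exact_mod_cast hp.ne_zero
  have hpA : (p : ℚ) ^ A ≠ 0 := pow_ne_zero _ hpQ
  have hA2 : 2 ≤ A := by omega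
  set W : ℕ → ℚ := blockWeight A B ε p n₀ N g with hW
  set ω : ℕ → ℚ := fun K => W K / p with hω
  -- `ω` is admissible for `N` at level `L` (verbatim from `BrickPropositionH.level_step`)
  have hωI : ∀ K, K ≤ N → Rat.padicValuation p (ω K) ≤ 1 := fun K hK => by
    have h := padicValuation_div_prime_le (p := p) (blockWeight_le hp2 hA hB hε hn₀ hgI hgS hgD hK)
    rwa [show (-1 : ℤ) + 1 = 0 by norm_num, exp_zero] at h
  have hωS : ∀ K, K ≤ N → Rat.padicValuation p (ω (N - K) + ω K) ≤ exp (-(L : ℤ)) := fun K hK => by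
    rw [hω]
    simp only
    rw [← add_div]
    have h := padicValuation_div_prime_le (p := p)
      (blockWeight_reflect_add_le hp2 (B := B) hA hε hn₀ (L := L) hgS hK)
    rwa [show -((L : ℤ) + 1) + 1 = -(L : ℤ) by ring] at h
  have hωD : ∀ e K K', 1 ≤ e → e ≤ L → K ≤ N → K' ≤ N → (p : ℤ) ^ e ∣ (K : ℤ) - K' →
      Rat.padicValuation p (ω K' - ω K) ≤ exp (-(e : ℤ)) := fun e K K' he heL hK hK' hdvd => by
    rw [hω]
    simp only
    rw [← sub_div]
    have h := padicValuation_div_prime_le (p := p)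
      (blockWeight_local hp2 (B := B) (ε := ε) hA hn₀ (L := L) hgI hgD he heL hK hK' hdvd)
    rwa [show -((e : ℤ) + 1) + 1 = -(e : ℤ) by ring] at h
  obtain ⟨IHs, IH0⟩ := IH N hN ω hωI hωS hωD
  have hWω : ∀ K, W K = (p : ℚ) * ω K := fun K => by rw [hω]; simp only; rw [mul_div_cancel₀ _ hpQ]
  have hpv : Rat.padicValuation p (p : ℚ) = exp (-1 : ℤ) := Rat.padicValuation_self p
  -- the hole weight `G = p^A·γ` on the row `N − 1`
  set G : ℕ → ℚ := holeWeight A B ε p n₀ (N - 1) g with hG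
  set γ : ℕ → ℚ := fun K => G K / (p : ℚ) ^ A with hγ
  have hGγ : ∀ K, G K = (p : ℚ) ^ A * γ K := fun K => by rw [hγ]; simp only; rw [mul_div_cancel₀ _ hpA]
  have hhole : (∀ s, Rat.padicValuation p (∑ K ∈ range N, G K * ((p : ℚ) ^ (L * (A - s)) * cell A B 0 (N - 1) K s)) ≤
      exp (-((L : ℤ) + 1))) ∧
      Rat.padicValuation p (∑ K ∈ range N, G K * ((p : ℚ) ^ (L * A) * cellZero A B 0 (N - 1) K)) ≤
        exp (-((L : ℤ) + 1)) := by
    rcases N with _ | m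
    · simp only [Finset.range_zero, Finset.sum_empty, map_zero]
      exact ⟨fun _ => _root_.zero_le, _root_.zero_le⟩
    · rw [Nat.add_sub_cancel] at hG ⊢
      have hm : m < p ^ (L + 1) := by omega
      -- `γ` is admissible for `m` at level `L`
      have hγI : ∀ K, K ≤ m → Rat.padicValuation p (γ K) ≤ 1 := fun K hK => by
        have h := padicValuation_div_pow_le (p := p) A (holeWeight_le hp2 hA hAB hn₀ (ε := ε) hgI hK)
        rw [neg_add_cancel, exp_zero] at h
        simpa only [hγ, hG] using h
      have hγS : ∀ K, K ≤ m → Rat.padicValuation p (γ (m - K) + γ K) ≤ exp (-(L : ℤ)) := fun K hK => by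
        have h := padicValuation_div_pow_le (p := p) A
          (holeWeight_reflect_add_le hp2 hA hAB (ε := ε) hε hn₀ (L := L) hgS hK)
        have h' : Rat.padicValuation p ((G (m - K) + G K) / (p : ℚ) ^ A) ≤ exp (-(L : ℤ)) := by
          rw [hG]; exact h.trans (exp_le_exp.2 (by omega))
        simpa only [hγ, add_div] using h'
      have hγD : ∀ e K K', 1 ≤ e → e ≤ L → K ≤ m → K' ≤ m → (p : ℤ) ^ e ∣ (K : ℤ) - K' →
          Rat.padicValuation p (γ K' - γ K) ≤ exp (-(e : ℤ)) := fun e K K' he heL hK hK' hdvd => by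
        have h := padicValuation_div_pow_le (p := p) A
          (holeWeight_local hp2 hA hAB (ε := ε) hn₀ (L := L) hgI hgD he heL hK hK' hdvd)
        have h' : Rat.padicValuation p ((G K' - G K) / (p : ℚ) ^ A) ≤ exp (-(e : ℤ)) := by
          rw [hG]; exact h.trans (exp_le_exp.2 (by omega))
        simpa only [hγ, sub_div] using h'
      obtain ⟨Hs, H0⟩ := IH m hm γ hγI hγS hγD
      have hpvA : Rat.padicValuation p ((p : ℚ) ^ A) = exp (-(A : ℤ)) := by
        rw [map_pow, hpv, ← exp_nsmul, nsmul_eq_mul, mul_neg_one]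
      refine ⟨fun s => ?_, ?_⟩
      · rw [show ∑ K ∈ range (m + 1), G K * ((p : ℚ) ^ (L * (A - s)) * cell A B 0 m K s) =
          (p : ℚ) ^ A * ∑ K ∈ range (m + 1), γ K * ((p : ℚ) ^ (L * (A - s)) * cell A B 0 m K s) by
            rw [Finset.mul_sum]; exact Finset.sum_congr rfl fun K _ => by rw [hGγ K]; ring, map_mul, hpvA]
        calc _ ≤ exp (-(A : ℤ)) * exp (-(L : ℤ)) := mul_le_mul' le_rfl (Hs s)
          _ ≤ _ := by rw [← exp_add, exp_le_exp]; omega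
      · rw [show ∑ K ∈ range (m + 1), G K * ((p : ℚ) ^ (L * A) * cellZero A B 0 m K) =
          (p : ℚ) ^ A * ∑ K ∈ range (m + 1), γ K * ((p : ℚ) ^ (L * A) * cellZero A B 0 m K) by
            rw [Finset.mul_sum]; exact Finset.sum_congr rfl fun K _ => by rw [hGγ K]; ring, map_mul, hpvA]
        calc _ ≤ exp (-(A : ℤ)) * exp (-(L : ℤ)) := mul_le_mul' le_rfl H0
          _ ≤ _ := by rw [← exp_add, exp_le_exp]; omega
  refine ⟨?_, fun s => ?_⟩
  · have hred := level_reduction_inf_zero hp2 hAB hB hε hn₀ hN hgI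
    have hmain : Rat.padicValuation p (∑ K ∈ range (N + 1),
        blockWeight A B ε p n₀ N g K * ((p : ℚ) ^ (L * A) * cellZero A B 0 N K)) ≤ exp (-((L : ℤ) + 1)) := by
      rw [← hW, show ∑ K ∈ range (N + 1), W K * ((p : ℚ) ^ (L * A) * cellZero A B 0 N K) =
        (p : ℚ) * ∑ K ∈ range (N + 1), ω K * ((p : ℚ) ^ (L * A) * cellZero A B 0 N K) by
          rw [Finset.mul_sum]; exact Finset.sum_congr rfl fun K _ => by rw [hWω K]; ring, map_mul, hpv]
      calc _ ≤ exp (-1 : ℤ) * exp (-(L : ℤ)) := mul_le_mul' le_rfl IH0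
        _ = _ := by rw [← exp_add]; congr 1; ring
    rw [← hG] at hred
    have h := Valuation.map_add_le _ (Valuation.map_add_le _ hred hhole.2) hmain
    rwa [sub_add_cancel, sub_add_cancel] at h
  · have hred := level_reduction_inf hp2 hAB hB hε hn₀ hN hgI s
    have hmain : Rat.padicValuation p (∑ K ∈ range (N + 1),
        blockWeight A B ε p n₀ N g K * ((p : ℚ) ^ (L * (A - s)) * cell A B 0 N K s)) ≤ exp (-((L : ℤ) + 1)) := by
      rw [← hW, show ∑ K ∈ range (N + 1), W K * ((p : ℚ) ^ (L * (A - s)) * cell A B 0 N K s) =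
        (p : ℚ) * ∑ K ∈ range (N + 1), ω K * ((p : ℚ) ^ (L * (A - s)) * cell A B 0 N K s) by
          rw [Finset.mul_sum]; exact Finset.sum_congr rfl fun K _ => by rw [hWω K]; ring, map_mul, hpv]
      calc _ ≤ exp (-1 : ℤ) * exp (-(L : ℤ)) := mul_le_mul' le_rfl (IHs s)
        _ = _ := by rw [← exp_add]; congr 1; ring
    rw [← hG] at hred
    have h := Valuation.map_add_le _ (Valuation.map_add_le _ hred (hhole.1 s)) hmain
    rwa [sub_add_cancel, sub_add_cancel] at h

end step

/-! ## PROPOSITION H^∞ -/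

/-- **PROPOSITION H^∞** (zi-p2 THEOREM 10 (v)): for an odd prime `p`, `A` even, `1 ≤ B`, `2B ≤ A`, EVERY level `ℓ`,
every row `M < p^{ℓ+1}` of the symmetric kernel and every admissible weight `g` ((I), (S_ℓ), (D)):
`v(Σ_{k≤M} g(k)·p^{ℓ(A−s)}·c̃_{k,s}(M)) ≤ exp(−ℓ)` for every `s`, and `v(Σ_{k≤M} g(k)·p^{ℓA}·cell̃^{(0)}_k(M)) ≤ exp(−ℓ)`
— `BrickPropositionH.propositionH` with the hypothesis `ℓ ≤ A` REMOVED. -/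
theorem propositionH_inf (hp2 : p ≠ 2) {A B : ℕ} (hA : Even A) (hB : 1 ≤ B) (hAB : 2 * B ≤ A) :
    ∀ ℓ : ℕ, ∀ M : ℕ, M < p ^ (ℓ + 1) → ∀ g : ℕ → ℚ, (∀ k, k ≤ M → Rat.padicValuation p (g k) ≤ 1) →
      (∀ k, k ≤ M → Rat.padicValuation p (g (M - k) + g k) ≤ exp (-(ℓ : ℤ))) →
      (∀ e k k', 1 ≤ e → e ≤ ℓ → k ≤ M → k' ≤ M → (p : ℤ) ^ e ∣ (k : ℤ) - k' →
        Rat.padicValuation p (g k' - g k) ≤ exp (-(e : ℤ))) →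
      (∀ s, Rat.padicValuation p (∑ k ∈ range (M + 1), g k * ((p : ℚ) ^ (ℓ * (A - s)) * cell A B 0 M k s)) ≤
        exp (-(ℓ : ℤ))) ∧
      Rat.padicValuation p (∑ k ∈ range (M + 1), g k * ((p : ℚ) ^ (ℓ * A) * cellZero A B 0 M k)) ≤ exp (-(ℓ : ℤ)) := by
  have hp : p.Prime := Fact.out
  intro ℓ
  induction ℓ with
  | zero =>
    intro M hM g hgI hgS hgD
    exact propositionH hp2 hA hB hAB 0 (Nat.zero_le A) M hM g hgI hgS hgD
  | succ L ih =>
    intro M hM g hgI hgS hgD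
    obtain ⟨n₀, N, hn₀, rfl⟩ : ∃ n₀ N, n₀ < p ∧ M = n₀ + N * p :=
      ⟨M % p, M / p, Nat.mod_lt _ hp.pos, (Nat.mod_add_div' M p).symm⟩
    have hN : N < p ^ (L + 1) := by
      rw [Nat.lt_iff_add_one_le]
      by_contra h
      have h' : p ^ (L + 1) ≤ N := by omega
      have : p ^ (L + 1 + 1) ≤ n₀ + N * p := by
        calc p ^ (L + 1 + 1) = p ^ (L + 1) * p := pow_succ _ _
          _ ≤ N * p := Nat.mul_le_mul_right _ h'
          _ ≤ n₀ + N * p := Nat.le_add_left _ _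
      omega
    have hgS' : ∀ k, k ≤ n₀ + N * p →
        Rat.padicValuation p (g (n₀ + N * p - k) + (-1) ^ 0 * g k) ≤ exp (-((L : ℤ) + 1)) := fun k hk => by
      rw [pow_zero, one_mul]; exact_mod_cast hgS k hk
    have h := level_step_inf hp2 hA hB hAB (ε := 0) (Nat.zero_le 1) hn₀ hN hgI hgS'
      (fun e k k' he heL hk hk' hdvd => hgD e k k' he (by omega) hk hk' hdvd)
      (fun M' hM' g' h1 h2 h3 => ih M' hM' g' h1 h2 h3)
    obtain ⟨h2, h1⟩ := h
    exact ⟨fun s => by exact_mod_cast h1 s, by exact_mod_cast h2⟩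

/-! ## DIGIT THEOREM 10 -/

section digit

variable (hp3 : 3 < p) {A B L n : ℕ} (hA : Even A) (hB : 1 ≤ B) (hAB : 2 * B ≤ A) (hn : n < p ^ (L + 1 + 1))
include hp3 hA hB hAB hn

/-- **DIGIT THEOREM 10** (zi-p2 THEOREM 10 (vi); `p ≥ 5`, `A` even, `1 ≤ B`, `2B ≤ A`; EVERY `L`, `n < p^{L+2}`):
with the weight `u_n(j) = (Φ_{n,p}(−j) − 1)/p³` and the level-`(L+1)` residues of the full kernel:
`v(Σ_{j≤n} u_n(j)·p^{(L+1)(A−s)}c_{j,s}(n)) ≤ exp(−(L+1))` for every `s`, together with the harmonic cell. -/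
theorem digitTheorem_inf :
    Rat.padicValuation p (∑ j ∈ range (n + 1),
      phiWeight A B p n j * ((p : ℚ) ^ ((L + 1) * A) * cellZero A B 1 n j)) ≤ exp (-((L : ℤ) + 1)) ∧
    (∀ s, Rat.padicValuation p (∑ j ∈ range (n + 1),
      phiWeight A B p n j * ((p : ℚ) ^ ((L + 1) * (A - s)) * cell A B 1 n j s)) ≤ exp (-((L : ℤ) + 1))) := by
  have hp : p.Prime := Fact.out
  have hp2 : p ≠ 2 := by omega
  obtain ⟨n₀, N, hn₀, rfl⟩ : ∃ n₀ N, n₀ < p ∧ n = n₀ + N * p :=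
    ⟨n % p, n / p, Nat.mod_lt _ hp.pos, (Nat.mod_add_div' n p).symm⟩
  have hN : N < p ^ (L + 1) := by
    rw [Nat.lt_iff_add_one_le]
    by_contra h
    have h' : p ^ (L + 1) ≤ N := by omega
    have : p ^ (L + 1 + 1) ≤ n₀ + N * p := by
      calc p ^ (L + 1 + 1) = p ^ (L + 1) * p := pow_succ _ _
        _ ≤ N * p := Nat.mul_le_mul_right _ h'
        _ ≤ n₀ + N * p := Nat.le_add_left _ _
    omega
  refine level_step_inf hp2 hA hB hAB (ε := 1) le_rfl hn₀ hN (g := fun k : ℕ => phiWeight A B p (n₀ + N * p) k)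
    (fun k _ => padicValuation_phiWeight_le hp3 hAB _ _) (fun k hk => ?_) (fun e k k' _ _ _ _ hdvd => ?_)
    (fun M' hM' g' h1 h2 h3 => propositionH_inf hp2 hA hB hAB L M' hM' g' h1 h2 h3)
  · rw [pow_one, neg_one_mul, ← sub_eq_add_neg, phiWeight_reflect hp2 A B hk, sub_self, map_zero]
    exact _root_.zero_le
  · exact padicValuation_phiWeight_sub_le hp3 hAB _ hdvd

end digit

end

end Summit.KontsevichZagierPeriods.Zeta5Search.BrickPropositionHInf
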